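import Mathlib.AlgebraicGeometry.Morphisms.Flat
import HarnessLib

/-!
# Affine base change of sections along a field-valued point (Görtz–Wedhorn II, proof of Prop. 22.90)

Let
```
Z --g--> Y
|prZ     |pr
Spec L --τ--> B ⊇ V
```
be a cartesian square of schemes with `L` a commutative ring (in the application a field: a
field-valued point `τ` of the base `B`), `V ⊆ B` an open containing the image of `τ`, and
`W ⊆ pr⁻¹V` an open of `Y`. Writing `A = Γ(V, 𝒪_B)`, the ring `Γ(W, 𝒪_Y)` is an `A`-algebra
through `pr^♯`, `L = Γ(Spec L, 𝒪)` is an `A`-algebra through `τ^♯` ("evaluation at `τ`"), and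
`Γ(g⁻¹W, 𝒪_Z)` is an `L`-algebra through `prZ^♯`; the maps `g^♯ : Γ(W, 𝒪_Y) → Γ(g⁻¹W, 𝒪_Z)` and
`L → Γ(g⁻¹W, 𝒪_Z)` induce the **base change map**
`L ⊗_A Γ(W, 𝒪_Y) → Γ(g⁻¹W, 𝒪_Z)`. When `V` and `W` are affine it is an isomorphism
(Görtz–Wedhorn II, proof of Prop. 22.90, p. 388: "we have `𝓕(V) ⊗_A A' = 𝓕(u'⁻¹(V), 𝓕')` for
every open affine subscheme `V ⊆ X`", here for `𝓕 = 𝒪`; `g⁻¹W = W ×_V Spec L` is the spectrum of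
`Γ(W, 𝒪_Y) ⊗_A L`). Mathlib has exactly this, for arbitrary cartesian squares and affine opens, as
`isIso_pushoutSection_of_isAffineOpen` (a pushout square of rings); this file repackages it in the
form used by the Čech computation of `H⁰` of the fibres of `X ×_K T → T` over field-valued points
(`Motives/GrothendieckComplexFieldPointsCech`, fact `cechComplex_h0_fieldPoint`):

* `FieldPointBaseChange.isPushout_algebraMap` — the square of rings `A → L`, `A → Γ(W, 𝒪_Y)`,
  `L → Γ(g⁻¹W, 𝒪_Z)`, `g^♯ : Γ(W, 𝒪_Y) → Γ(g⁻¹W, 𝒪_Z)` is a pushout (`V`, `W` affine);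
* `FieldPointBaseChange.tensorIso`, `tensorEquiv` — the resulting ring isomorphism
  `L ⊗_A Γ(W, 𝒪_Y) ≅ Γ(g⁻¹W, 𝒪_Z)`, `l ⊗ r ↦ l · g^♯(r)` (`tensorIso_tmul`), and the same map as an
  `L`-linear isomorphism;
* `FieldPointBaseChange.map_tensorEquiv` — naturality in `W`: restriction to a smaller open
  `W₂ ⊆ W₁` on the right corresponds to `L ⊗_A (restriction)` on the left.

The algebra structures are instance arguments tied to the morphisms by explicit equations
(`hφ`, `hW`, `hZ`), to be supplied as `RingHom.toAlgebra _` / `rfl` by users (the style of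
`Motives/CartierDivisorSectionsOn`). Mathlib searched and used (pin):
`isIso_pushoutSection_of_isAffineOpen`, `isIso_pushoutSection_iff`,
`CommRingCat.isPushout_tensorProduct`, `IsPushout.isoIsPushout`, `IsPushout.of_iso`,
`Scheme.Hom.appLE_map`, `Scheme.Hom.map_appLE`; Mathlib states the affine base change only in
the `pushout`/`IsPushout` language, not for the concrete tensor product acting on sections.

## References

* U. Görtz, T. Wedhorn, *Algebraic Geometry II: Cohomology of Schemes*, Springer Spektrum (2023),
  doi:10.1007/978-3-658-43031-3: Prop. 22.90 and its proof, pp. 387–388 (read via the held copy).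
  [GortzWedhorn2023]
* U. Görtz, T. Wedhorn, *Algebraic Geometry I: Schemes*, 2nd ed. (2020): Prop. 4.18 / (4.9)
  (fibre products of affine schemes are spectra of tensor products). [GortzWedhorn2020]
-/

universe u

open CategoryTheory CategoryTheory.Limits AlgebraicGeometry TopologicalSpace Opposite
open TensorProduct

noncomputable section

namespace Literature.AlgebraicGeometry.Motives

namespace FieldPointBaseChange

variable {L : Type u} [CommRing L] {B Y Z : Scheme.{u}} {pr : Y ⟶ B} {g : Z ⟶ Y}
  {prZ : Z ⟶ Spec (.of L)} {τ : Spec (.of L) ⟶ B} (H : IsPullback g prZ pr τ)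
  {V : B.Opens} (htV : (⊤ : (Spec (CommRingCat.of L)).Opens) ≤ τ ⁻¹ᵁ V)
  [Algebra Γ(B, V) L]
  (hφ : CommRingCat.ofHom (algebraMap Γ(B, V) L) =
    τ.appLE V ⊤ htV ≫ (Scheme.ΓSpecIso (.of L)).hom)

/-! ### The pushout square of rings attached to an affine open `W ⊆ pr⁻¹V` -/

section OneOpen

variable {W : Y.Opens} (hWV : W ≤ pr ⁻¹ᵁ V) [Algebra Γ(B, V) Γ(Y, W)]
  (hW : CommRingCat.ofHom (algebraMap Γ(B, V) Γ(Y, W)) = pr.appLE V W hWV)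
  [Algebra L Γ(Z, g ⁻¹ᵁ W)]
  (hZ : CommRingCat.ofHom (algebraMap L Γ(Z, g ⁻¹ᵁ W)) =
    (Scheme.ΓSpecIso (.of L)).inv ≫ prZ.appLE ⊤ (g ⁻¹ᵁ W) le_top)

include H hφ hW hZ in
/-- **Affine base change of sections** (Görtz–Wedhorn II, proof of Prop. 22.90, p. 388:
"`𝓕(V) ⊗_A A' = 𝓕(u'⁻¹(V), 𝓕')` for every open affine subscheme `V`", for `𝓕 = 𝒪`): for `V` and
`W ⊆ pr⁻¹V` affine, the square of rings `A = Γ(V, 𝒪_B) → L`, `A → Γ(W, 𝒪_Y)`,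
`L → Γ(g⁻¹W, 𝒪_Z)`, `g^♯ : Γ(W, 𝒪_Y) → Γ(g⁻¹W, 𝒪_Z)` is a pushout, i.e.
`L ⊗_A Γ(W, 𝒪_Y) ≅ Γ(g⁻¹W, 𝒪_Z)` (Mathlib `isIso_pushoutSection_of_isAffineOpen`, with
`Γ(Spec L, 𝒪) ≅ L`). [cite: GortzWedhorn2023, Prop. 22.90, proof (p. 388)] -/
theorem isPushout_algebraMap (hVaff : IsAffineOpen V) (hWaff : IsAffineOpen W) :
    IsPushout (CommRingCat.ofHom (algebraMap Γ(B, V) L))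
      (CommRingCat.ofHom (algebraMap Γ(B, V) Γ(Y, W)))
      (CommRingCat.ofHom (algebraMap L Γ(Z, g ⁻¹ᵁ W))) (g.appLE W (g ⁻¹ᵁ W) le_rfl) := by
  have hUY : g ⁻¹ᵁ W = g ⁻¹ᵁ W ⊓ prZ ⁻¹ᵁ ⊤ := by simp
  have h1 := isIso_pushoutSection_of_isAffineOpen H (US := V) (UT := ⊤) (UX := W) htV hWV hUY
    hVaff (isAffineOpen_top _) hWaff
  have sq := (isIso_pushoutSection_iff H (US := V) (UT := ⊤) (UX := W) htV hWV hUY).mp h1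
  refine sq.flip.of_iso (Iso.refl _) (Scheme.ΓSpecIso (.of L)) (Iso.refl _) (Iso.refl _)
    ?_ ?_ ?_ ?_
  · rw [Iso.refl_hom, Category.id_comp]
    exact hφ.symm
  · rw [Iso.refl_hom, Iso.refl_hom, Category.comp_id, Category.id_comp]
    exact hW.symm
  · rw [Iso.refl_hom, Category.comp_id, hZ, Iso.hom_inv_id_assoc]
  · rw [Iso.refl_hom, Iso.refl_hom, Category.comp_id, Category.id_comp]

/-- **`L ⊗_A Γ(W, 𝒪_Y) ≅ Γ(g⁻¹W, 𝒪_Z)`** as commutative rings, for `V`, `W` affine: the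
comparison of the abstract pushout `L ⊗_A Γ(W, 𝒪_Y)` (Mathlib
`CommRingCat.isPushout_tensorProduct`) with the pushout `Γ(g⁻¹W, 𝒪_Z)` of
`isPushout_algebraMap`. [cite: GortzWedhorn2023, Prop. 22.90, proof (p. 388)] -/
def tensorIso (hVaff : IsAffineOpen V) (hWaff : IsAffineOpen W) :
    CommRingCat.of (L ⊗[Γ(B, V)] Γ(Y, W)) ≅ Γ(Z, g ⁻¹ᵁ W) :=
  (CommRingCat.isPushout_tensorProduct Γ(B, V) L Γ(Y, W)).isoIsPushout _ _
    (isPushout_algebraMap H htV hφ hWV hW hZ hVaff hWaff)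

/-- Under `L ⊗_A Γ(W, 𝒪_Y) ≅ Γ(g⁻¹W, 𝒪_Z)`, `l ⊗ 1 ↦ l` (through `L → Γ(g⁻¹W, 𝒪_Z)`).
[folklore] -/
theorem includeLeft_tensorIso (hVaff : IsAffineOpen V) (hWaff : IsAffineOpen W) :
    CommRingCat.ofHom (Algebra.TensorProduct.includeLeftRingHom) ≫
        (tensorIso H htV hφ hWV hW hZ hVaff hWaff).hom =
      CommRingCat.ofHom (algebraMap L Γ(Z, g ⁻¹ᵁ W)) :=
  IsPushout.inl_isoIsPushout_hom _ _ _ _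

/-- Under `L ⊗_A Γ(W, 𝒪_Y) ≅ Γ(g⁻¹W, 𝒪_Z)`, `1 ⊗ r ↦ g^♯(r)`. [folklore] -/
theorem includeRight_tensorIso (hVaff : IsAffineOpen V) (hWaff : IsAffineOpen W) :
    CommRingCat.ofHom (Algebra.TensorProduct.includeRight (R := Γ(B, V)) (A := L)
        (B := Γ(Y, W))).toRingHom ≫ (tensorIso H htV hφ hWV hW hZ hVaff hWaff).hom =
      g.appLE W (g ⁻¹ᵁ W) le_rfl :=
  IsPushout.inr_isoIsPushout_hom _ _ _ _

/-- The comparison isomorphism on pure tensors: `l ⊗ r ↦ l · g^♯(r)`. [folklore] -/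
theorem tensorIso_tmul (hVaff : IsAffineOpen V) (hWaff : IsAffineOpen W) (l : L) (r : Γ(Y, W)) :
    (tensorIso H htV hφ hWV hW hZ hVaff hWaff).hom (l ⊗ₜ r) =
      algebraMap L Γ(Z, g ⁻¹ᵁ W) l * g.appLE W (g ⁻¹ᵁ W) le_rfl r := by
  have e : l ⊗ₜ[Γ(B, V)] r = (l ⊗ₜ[Γ(B, V)] (1 : Γ(Y, W))) * ((1 : L) ⊗ₜ[Γ(B, V)] r) := by
    rw [Algebra.TensorProduct.tmul_mul_tmul, mul_one, one_mul]
  rw [e, map_mul]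
  congr 1
  · exact congr($(includeLeft_tensorIso H htV hφ hWV hW hZ hVaff hWaff).hom l)
  · exact congr($(includeRight_tensorIso H htV hφ hWV hW hZ hVaff hWaff).hom r)

/-- **`L ⊗_A Γ(W, 𝒪_Y) ≅ Γ(g⁻¹W, 𝒪_Z)` as `L`-modules** (`Γ(g⁻¹W, 𝒪_Z)` an `L`-module through
`prZ^♯`): the ring isomorphism `tensorIso` is `L`-linear since it maps `l ⊗ 1 ↦ l`.
[cite: GortzWedhorn2023, Prop. 22.90, proof (p. 388)] -/
def tensorEquiv (hVaff : IsAffineOpen V) (hWaff : IsAffineOpen W) :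
    L ⊗[Γ(B, V)] Γ(Y, W) ≃ₗ[L] Γ(Z, g ⁻¹ᵁ W) :=
  { (tensorIso H htV hφ hWV hW hZ hVaff hWaff).commRingCatIsoToRingEquiv.toAddEquiv with
    map_smul' := fun l x => by
      change (tensorIso H htV hφ hWV hW hZ hVaff hWaff).hom (l • x) =
        l • (tensorIso H htV hφ hWV hW hZ hVaff hWaff).hom x
      rw [Algebra.smul_def, Algebra.TensorProduct.algebraMap_apply, Algebra.algebraMap_self,
        RingHom.id_apply, map_mul, tensorIso_tmul, map_one, mul_one, Algebra.smul_def] }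

/-- `tensorEquiv` is `tensorIso` on elements. [folklore] -/
@[simp] theorem tensorEquiv_apply (hVaff : IsAffineOpen V) (hWaff : IsAffineOpen W)
    (x : L ⊗[Γ(B, V)] Γ(Y, W)) :
    tensorEquiv H htV hφ hWV hW hZ hVaff hWaff x = (tensorIso H htV hφ hWV hW hZ hVaff hWaff).hom x :=
  rfl

/-- `tensorEquiv` on pure tensors: `l ⊗ r ↦ l · g^♯(r)`. [folklore] -/
theorem tensorEquiv_tmul (hVaff : IsAffineOpen V) (hWaff : IsAffineOpen W) (l : L) (r : Γ(Y, W)) :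
    tensorEquiv H htV hφ hWV hW hZ hVaff hWaff (l ⊗ₜ r) =
      algebraMap L Γ(Z, g ⁻¹ᵁ W) l * g.appLE W (g ⁻¹ᵁ W) le_rfl r :=
  tensorIso_tmul H htV hφ hWV hW hZ hVaff hWaff l r

/-- `tensorEquiv` is multiplicative (it is a ring isomorphism). [folklore] -/
theorem tensorEquiv_mul (hVaff : IsAffineOpen V) (hWaff : IsAffineOpen W)
    (x y : L ⊗[Γ(B, V)] Γ(Y, W)) :
    tensorEquiv H htV hφ hWV hW hZ hVaff hWaff (x * y) =
      tensorEquiv H htV hφ hWV hW hZ hVaff hWaff x * tensorEquiv H htV hφ hWV hW hZ hVaff hWaff y :=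
  map_mul (tensorIso H htV hφ hWV hW hZ hVaff hWaff).hom.hom x y

end OneOpen

/-! ### Naturality in `W` -/

section TwoOpens

variable {W₁ W₂ : Y.Opens} (h₁₂ : W₂ ≤ W₁) (hWV₁ : W₁ ≤ pr ⁻¹ᵁ V)
  [Algebra Γ(B, V) Γ(Y, W₁)] [Algebra Γ(B, V) Γ(Y, W₂)]
  (hW₁ : CommRingCat.ofHom (algebraMap Γ(B, V) Γ(Y, W₁)) = pr.appLE V W₁ hWV₁)
  (hW₂ : CommRingCat.ofHom (algebraMap Γ(B, V) Γ(Y, W₂)) = pr.appLE V W₂ (h₁₂.trans hWV₁))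
  [Algebra L Γ(Z, g ⁻¹ᵁ W₁)] [Algebra L Γ(Z, g ⁻¹ᵁ W₂)]
  (hZ₁ : CommRingCat.ofHom (algebraMap L Γ(Z, g ⁻¹ᵁ W₁)) =
    (Scheme.ΓSpecIso (.of L)).inv ≫ prZ.appLE ⊤ (g ⁻¹ᵁ W₁) le_top)
  (hZ₂ : CommRingCat.ofHom (algebraMap L Γ(Z, g ⁻¹ᵁ W₂)) =
    (Scheme.ΓSpecIso (.of L)).inv ≫ prZ.appLE ⊤ (g ⁻¹ᵁ W₂) le_top)

include hW₁ hW₂ in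
/-- Restriction `Γ(W₁, 𝒪_Y) → Γ(W₂, 𝒪_Y)` is `A`-linear (both are `A`-algebras through `pr^♯`).
[folklore] -/
theorem map_algebraMap (a : Γ(B, V)) :
    Y.presheaf.map (homOfLE h₁₂).op (algebraMap Γ(B, V) Γ(Y, W₁) a) =
      algebraMap Γ(B, V) Γ(Y, W₂) a := by
  have e₁ : algebraMap Γ(B, V) Γ(Y, W₁) a = pr.appLE V W₁ hWV₁ a := congr($(hW₁).hom a)
  have e₂ : algebraMap Γ(B, V) Γ(Y, W₂) a = pr.appLE V W₂ (h₁₂.trans hWV₁) a := congr($(hW₂).hom a)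
  rw [e₁, e₂, ← CommRingCat.comp_apply, Scheme.Hom.appLE_map]

/-- Restriction `Γ(W₁, 𝒪_Y) → Γ(W₂, 𝒪_Y)` as an `A`-linear map. [folklore] -/
def restrictₗ : Γ(Y, W₁) →ₗ[Γ(B, V)] Γ(Y, W₂) where
  toFun := Y.presheaf.map (homOfLE h₁₂).op
  map_add' := map_add _
  map_smul' a r := by
    rw [RingHom.id_apply, Algebra.smul_def, Algebra.smul_def, map_mul,
      map_algebraMap h₁₂ hWV₁ hW₁ hW₂]

/-- `restrictₗ` is restriction. [folklore] -/
@[simp] theorem restrictₗ_apply (r : Γ(Y, W₁)) :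
    restrictₗ h₁₂ hWV₁ hW₁ hW₂ r = Y.presheaf.map (homOfLE h₁₂).op r := rfl

include hZ₁ hZ₂ in
/-- Restriction `Γ(g⁻¹W₁, 𝒪_Z) → Γ(g⁻¹W₂, 𝒪_Z)` is `L`-linear. [folklore] -/
theorem map_algebraMap_fibre (l : L) :
    Z.presheaf.map (homOfLE (g.preimage_mono h₁₂)).op (algebraMap L Γ(Z, g ⁻¹ᵁ W₁) l) =
      algebraMap L Γ(Z, g ⁻¹ᵁ W₂) l := by
  have e₁ : algebraMap L Γ(Z, g ⁻¹ᵁ W₁) l =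
      prZ.appLE ⊤ (g ⁻¹ᵁ W₁) le_top ((Scheme.ΓSpecIso (.of L)).inv l) := congr($(hZ₁).hom l)
  have e₂ : algebraMap L Γ(Z, g ⁻¹ᵁ W₂) l =
      prZ.appLE ⊤ (g ⁻¹ᵁ W₂) le_top ((Scheme.ΓSpecIso (.of L)).inv l) := congr($(hZ₂).hom l)
  rw [e₁, e₂, ← CommRingCat.comp_apply, Scheme.Hom.appLE_map]

include hφ hW₁ hW₂ hZ₁ hZ₂ in
/-- **Naturality of the base change isomorphism in `W`**: for affine `W₂ ⊆ W₁ ⊆ pr⁻¹V`,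
restricting `Γ(g⁻¹W₁, 𝒪_Z) → Γ(g⁻¹W₂, 𝒪_Z)` after `L ⊗_A Γ(W₁, 𝒪_Y) ≅ Γ(g⁻¹W₁, 𝒪_Z)` is
`L ⊗_A (restriction)` followed by `L ⊗_A Γ(W₂, 𝒪_Y) ≅ Γ(g⁻¹W₂, 𝒪_Z)` (both send `l ⊗ r` to
`l · g^♯(r|_{W₂})`). [folklore] -/
theorem map_tensorEquiv (hVaff : IsAffineOpen V) (hWaff₁ : IsAffineOpen W₁)
    (hWaff₂ : IsAffineOpen W₂) (x : L ⊗[Γ(B, V)] Γ(Y, W₁)) :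
    Z.presheaf.map (homOfLE (g.preimage_mono h₁₂)).op
        (tensorEquiv H htV hφ hWV₁ hW₁ hZ₁ hVaff hWaff₁ x) =
      tensorEquiv H htV hφ (h₁₂.trans hWV₁) hW₂ hZ₂ hVaff hWaff₂
        (LinearMap.lTensor L (restrictₗ h₁₂ hWV₁ hW₁ hW₂) x) := by
  induction x using TensorProduct.induction_on with
  | zero => simp only [map_zero]
  | add x y hx hy => simp only [map_add, hx, hy]
  | tmul l r =>
    rw [LinearMap.lTensor_tmul, tensorEquiv_tmul, tensorEquiv_tmul, map_mul,
      map_algebraMap_fibre h₁₂ hZ₁ hZ₂, restrictₗ_apply, ← CommRingCat.comp_apply,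
      ← CommRingCat.comp_apply, Scheme.Hom.appLE_map, Scheme.Hom.map_appLE]

end TwoOpens

end FieldPointBaseChange

end Literature.AlgebraicGeometry.Motives

end
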